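/-
Copyright (c) 2026 the pub-hodgecm-mathlib formalisation cell (harness21).  Prover seat hodgecm-mathlib-K2E1-p10 (g5), Track B «K2-LIT», h413 = `stmt-HodgeConjecture-24833`,
R90-TF section S8 «ContSpec-n½», deal S8-R157 (2) of the S8 dealer R90-CS-plan (g3): THE PAYER OF THE LETTER `hE3c` (holomorphy of the constant term of the CONTINUED pair-Eisenstein
family on the slit plane `{1 < Re} ∖ Sp`, per `g`) for R90-CS-p03's (a-8) identity-theorem payer of `hfac`, stated in ★ p863385's binder bytes; census
`K2/K2E1-p10/g5/CENSUS-hE3c.K2E1-p10-g5.md` (10ec0a5edc378717).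
-/
import Literature.NumberTheory.Automorphic.UnitaryGroupBorelTruncation      -- ★ `borelConstantTerm ν 𝓕 φ g = (ν 𝓕).toReal⁻¹ • ∫_𝓕 φ(u g) dν(u)`, `adelicUnipotent`, `rationalUnipotent`
import Literature.NumberTheory.Automorphic.UnitaryGroupTorusSiegelIntegral   -- ★ `borelHeight_pos` (`H(g) > 0`, so `H(g)^w ≠ 0`)
import Literature.NumberTheory.Automorphic.UnitaryGroupOfFormAdelicTopology -- ★ `U(J)(𝔸_F)` is locally compact and second countable (instances on `adelic F E c N J`)
import Literature.Analysis.Complex.HolomorphicParametricIntegral             -- ★ `Literature.Analysis.Complex.differentiableOn_integral_of_dominated` (holomorphic dominated parameter integrals, no derivative data)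
import Mathlib.NumberTheory.NumberField.CMField
import Mathlib.MeasureTheory.Group.FundamentalDomain
import HarnessLib

/-!
# K2·E1 — `K2E1ChiConstantTermHolomorphicCMThree`: THE CONSTANT TERM OF A CONTINUED FAMILY IS AGAIN AN ADMISSIBLE FAMILY — HOLOMORPHY IN `z` (the letter `hE3c`), CONTINUITY
# IN `g`, AND THE JOINT LOCAL BOUND, FOR `z ↦ (Ec z)_B` ON `U(J_N)(𝔸_F)`; HEADS AT `U(2,1)_{L/L⁺}` ON THE SLIT PLANE `{1 < Re} ∖ Sp` IN THE (V) ASSEMBLY'S BYTES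

Track B ∕ K2-LIT, crux h413 = `stmt-HodgeConjecture-24833`, route of record `HCCMUnconditional`; cell `hodgecm-mathlib`, R90-TF section S8 «ContSpec-n½».  Prover seat
`hodgecm-mathlib-K2E1-p10` (g5), deal S8-R157 (2) of the S8 dealer R90-CS-plan (g3).  THEOREMS ONLY (no `def`, no `instance`, no notation, no named-fact hypothesis, no `sorry`;
default heartbeats); lane `--supports stmt-HodgeConjecture-24833 --as helper` (count-neutral).  CLOSES NO SOCKET: it pays the letter `hE3c` of the (a-8) payer of the (V)
assembly's `hfac` row (★ `R90S8ResGMidBlockNeBotAssemblyU3.resGMidBlock_ne_bot_assembly`, binders :285 `hEd`, :289 `hE4`, :290 `hEbd`, :292–:294 `ν h𝓕N h𝓕c`).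

THE MATHEMATICS ([MoeglinWaldspurger1995, II.1.7, IV.1.9]; [Rogawski1990, §2.1]).  The constant term along the Borel subgroup is `φ_B(g) = ν(𝓕)⁻¹ ∫_𝓕 φ(u g) dν(u)`, an integral over
a fundamental domain `𝓕` of the cocompact lattice `N(F) ≤ N(𝔸_F)` — a set of COMPACT closure and FINITE Haar measure.  For a family `z ↦ Φ_z : G(𝔸_F) → ℂ` carrying the three
LAYER-2 letters of the S8 board on an open `U ⊆ ℂ` — (E1) `z ↦ Φ_z(g)` holomorphic on `U` for every `g`, (E4) `Φ_z` continuous for `z ∈ U`, (E2-bd) `(z, g) ↦ Φ_z(g)` locally bounded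
on `U × (compacts)` — the integrand `(z, u) ↦ Φ_z(u g)` is holomorphic in `z`, measurable in `u ∈ 𝓕`, and dominated on `(nbhd of z₀) × closure 𝓕 · g` by a constant, so:
* §1 (E1)_B **`differentiableOn_borelConstantTerm_family`** — `z ↦ (Φ_z)_B(g)` is holomorphic on `U` (★ `Literature.Analysis.Complex.differentiableOn_integral_of_dominated`: Cauchy–Schwarz
  estimates under the integral sign, no derivative data; cf. the `N = 3`, Theorems-side precedent ★ `K2E1ContinuedEisensteinHeckeConstantTermCMThree.differentiableOn_borelConstantTerm_continued_cm_three`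
  (K2E4-p10), same road through ★ K2Liu `differentiableOn_integral_mul_family` — restated here for every `U(J_N)` with Literature imports only);
* §2 (E4)_B **`continuous_borelConstantTerm_of_continuous`** — `Φ` continuous ⇒ `Φ_B` continuous (dominated convergence on the finite measure `ν|_𝓕`, the bound coming from the
  compact `closure 𝓕 · K_{g₀}`, `K_{g₀}` a compact neighbourhood of `g₀` in the locally compact group `U(J_N)(𝔸_F)` ★);
* §3 (E2-bd)_B **`locally_bounded_borelConstantTerm_family`** — the joint local bound transports to `(z, g) ↦ (Φ_z)_B(g)` (constant `max M 0`; no measure hypothesis: `ν(𝓕) = ∞` gives `0`);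
* §4 (`hψa ⇐ hE3c`) **`differentiableOn_middleCoefficient_of_borelConstantTerm`** — the MIDDLE COEFFICIENT `ψ_z(g) = ((Φ_z)_B(g) − φ(g)·H(g)^z) ∕ H(g)^{2−z}` (K2E1-p12's def-free
  device for the section-shaped constant term `(Φ_z)_B = φ·H^z + ψ_z·H^{2−z}`) is holomorphic on `U` wherever `z ↦ (Φ_z)_B(g)` is (`H(g) > 0` ★, so `H(g)^w ≠ 0`; `φ(g)` is constant in `z`)
  — the letter `hψa` of the (a-8) payer ★ `K2E1ChiConstantTermFactorisationContinuedU3.eventually_factorisation_of_unfolded` read through `hE3c`;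
* §5 THE `U(2,1)_{L/L⁺}` HEADS ON THE SLIT PLANE `{1 < Re} ∖ Sp`, binders = ★ p863385's bytes: **`differentiableOn_borelConstantTerm_slitPlane_cm_three`** (= `hE3c`),
  `continuous_borelConstantTerm_slitPlane_cm_three`, `locally_bounded_borelConstantTerm_slitPlane_cm_three` — so `z ↦ (Ec z)_B` is itself an admissible continued family for the
  residue bricks (★ `continuous_residueValue_at`, ★ `residueFun_arithmetic_mul`, …) — and `differentiableOn_middleCoefficient_slitPlane_cm_three` (= `hψa` from `hE3c`'s inputs).
HONEST LABEL: HC_CM is proved only modulo the 7 printed citations (2 remaining named inputs: hLiu418 = `stmt-HodgeConjecture-24832`, h413 = `stmt-HodgeConjecture-24833`) until rung 0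
closes; this file asserts no named fact and closes no socket; every head is CONDITIONAL on the exports' letters (E1)(E4)(E2-bd) it is handed.
References: [MoeglinWaldspurger1995] C. Mœglin, J.-L. Waldspurger, *Spectral Decomposition and Eisenstein Series* (1995), II.1.7, IV.1.9 · [Rogawski1990] J. D. Rogawski, *Automorphic
Representations of Unitary Groups in Three Variables* (1990), §2.1.
-/

set_option autoImplicit false
-- the mandated namespace repeats the single-problem summit's segment (`HodgeConjecture.HodgeConjecture`)
set_option linter.dupNamespace false

noncomputable section

open MeasureTheory Measure NumberField Set Filter Topology Metric
open scoped ENNReal NNReal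
open Literature.NumberTheory.Automorphic Literature.NumberTheory.Automorphic.UnitaryGroup AdelicGroupData

namespace Summit.HodgeConjecture.HodgeConjecture.Cruxes.H413.K2E1ChiConstantTermHolomorphicCMThree

/-! ## §1–§3 Any `U(J_N)`: the three LAYER-2 letters of the constant-term family -/

section General

variable {F E : Type} [Field F] [NumberField F] [Field E] [NumberField E] [Algebra F E] {c : E ≃ₐ[F] E} {N : ℕ}
variable [MeasurableSpace (quasiSplit F E c N).Adelic] [BorelSpace (quasiSplit F E c N).Adelic]

/-- **(E1)_B — `z ↦ (Φ_z)_B(g)` IS HOLOMORPHIC ON `U`** for a family with (E1) pointwise holomorphy `hΦd`, (E4) continuity `hΦc` and (E2-bd) the joint local bound `hΦbd` on the open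
`U ⊆ ℂ`, any measure `ν` on `N(𝔸_F)` with `ν(𝓕) < ∞` on a null-measurable `𝓕` of compact closure: the integrand `(z, u) ↦ Φ_z(u g)` on `ν|_𝓕` is holomorphic in `z`, a.e.-strongly
measurable in `u`, and dominated near each `z₀ ∈ U` by the constant of `hΦbd` on the compact `closure 𝓕 · g` (★ `Literature.Analysis.Complex.differentiableOn_integral_of_dominated`), and
`(Φ_z)_B(g) = ν(𝓕)⁻¹ • ∫_𝓕 Φ_z(u g) dν`. [cite: MoeglinWaldspurger1995, II.1.7, IV.1.9] [cite: Rogawski1990, §2.1] -/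
theorem differentiableOn_borelConstantTerm_family (ν : Measure ↥(adelicUnipotent F E c N)) {𝓕 : Set ↥(adelicUnipotent F E c N)}
    (h𝓕m : NullMeasurableSet 𝓕 ν) (h𝓕top : ν 𝓕 ≠ ∞) (h𝓕c : IsCompact (closure 𝓕))
    (Φ : ℂ → (quasiSplit F E c N).Adelic → ℂ) {U : Set ℂ} (hUo : IsOpen U)
    (hΦd : ∀ g, DifferentiableOn ℂ (fun z => Φ z g) U) (hΦc : ∀ z ∈ U, Continuous (Φ z))
    (hΦbd : ∀ z₀ ∈ U, ∀ K : Set (quasiSplit F E c N).Adelic, IsCompact K → ∃ V ∈ 𝓝 z₀, ∃ M : ℝ, ∀ z ∈ V, ∀ g ∈ K, ‖Φ z g‖ ≤ M)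
    (g : (quasiSplit F E c N).Adelic) :
    DifferentiableOn ℂ (fun z => borelConstantTerm ν 𝓕 (Φ z) g) U := by
  haveI : IsFiniteMeasure (ν.restrict 𝓕) := isFiniteMeasure_restrict.2 h𝓕top
  have ha : Continuous fun u : ↥(adelicUnipotent F E c N) => (u : (quasiSplit F E c N).Adelic) * g :=
    continuous_subtype_val.mul continuous_const
  have hint : DifferentiableOn ℂ (fun z => ∫ u in 𝓕, Φ z ((u : (quasiSplit F E c N).Adelic) * g) ∂ν) U := by
    refine Literature.Analysis.Complex.differentiableOn_integral_of_dominated (μ := ν.restrict 𝓕)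
      (F := fun z u => Φ z ((u : (quasiSplit F E c N).Adelic) * g)) (fun z hz => ((hΦc z hz).comp ha).aestronglyMeasurable)
      (Eventually.of_forall fun u => hΦd _) fun z₀ hz₀ => ?_
    obtain ⟨V, hV, M, hM⟩ := hΦbd z₀ hz₀ _ (h𝓕c.image ha)
    obtain ⟨R, hR, hRsub⟩ := Metric.mem_nhds_iff.1 (inter_mem hV (hUo.mem_nhds hz₀))
    refine ⟨R, hR, fun z hz => (hRsub hz).2, fun _ => M, integrable_const M, ?_⟩
    filter_upwards [ae_restrict_mem₀ h𝓕m] with u hu z hz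
    exact hM z (hRsub hz).1 _ ⟨u, subset_closure hu, rfl⟩
  simp only [borelConstantTerm_def]
  exact hint.const_smul ((ν 𝓕).toReal⁻¹ : ℝ)

/-- **(E4)_B — `Φ` CONTINUOUS ⇒ `Φ_B` CONTINUOUS** (`ν(𝓕) < ∞`, `𝓕` null-measurable of compact closure): at `g₀`, on a compact neighbourhood `K_{g₀}` (★ `U(J_N)(𝔸_F)` is locally compact)
the integrands `u ↦ Φ(u g)`, `g ∈ K_{g₀}`, are bounded on `𝓕` by the maximum of `Φ` on the compact `closure 𝓕 · K_{g₀}`, so dominated convergence on the finite measure `ν|_𝓕` applies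
(Mathlib `continuousAt_of_dominated`; ★ second countability gives the first-countable topology it wants). [cite: MoeglinWaldspurger1995, II.1.7] [cite: Rogawski1990, §2.1] -/
theorem continuous_borelConstantTerm_of_continuous (ν : Measure ↥(adelicUnipotent F E c N)) {𝓕 : Set ↥(adelicUnipotent F E c N)}
    (h𝓕m : NullMeasurableSet 𝓕 ν) (h𝓕top : ν 𝓕 ≠ ∞) (h𝓕c : IsCompact (closure 𝓕))
    {Φ : (quasiSplit F E c N).Adelic → ℂ} (hΦ : Continuous Φ) :
    Continuous (borelConstantTerm ν 𝓕 Φ) := by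
  haveI : IsFiniteMeasure (ν.restrict 𝓕) := isFiniteMeasure_restrict.2 h𝓕top
  haveI : LocallyCompactSpace (quasiSplit F E c N).Adelic := inferInstanceAs (LocallyCompactSpace (adelic F E c N ((StdForm.antidiagonal N).over E)))
  haveI : SecondCountableTopology (quasiSplit F E c N).Adelic := inferInstanceAs (SecondCountableTopology (adelic F E c N ((StdForm.antidiagonal N).over E)))
  have hmul : Continuous fun q : ↥(adelicUnipotent F E c N) × (quasiSplit F E c N).Adelic => (q.1 : (quasiSplit F E c N).Adelic) * q.2 :=
    (continuous_subtype_val.comp continuous_fst).mul continuous_snd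
  have heq : borelConstantTerm ν 𝓕 Φ = fun g => ((ν 𝓕).toReal⁻¹ : ℝ) • ∫ u in 𝓕, Φ ((u : (quasiSplit F E c N).Adelic) * g) ∂ν := rfl
  rw [heq]
  refine continuous_iff_continuousAt.2 fun g₀ => ?_
  obtain ⟨Kg, hKg, hKg₀⟩ := exists_compact_mem_nhds g₀
  obtain ⟨M, hM⟩ := ((h𝓕c.prod hKg).image hmul).exists_bound_of_continuousOn hΦ.continuousOn
  have hint : ContinuousAt (fun g => ∫ u in 𝓕, Φ ((u : (quasiSplit F E c N).Adelic) * g) ∂ν) g₀ := by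
    refine continuousAt_of_dominated (bound := fun _ => M)
      (Eventually.of_forall fun g => (hΦ.comp (continuous_subtype_val.mul continuous_const)).aestronglyMeasurable) ?_ (integrable_const M)
      (Eventually.of_forall fun u => (hΦ.comp (continuous_const.mul continuous_id)).continuousAt)
    filter_upwards [hKg₀] with g hg
    filter_upwards [ae_restrict_mem₀ h𝓕m] with u hu
    exact hM _ ⟨(u, g), ⟨subset_closure hu, hg⟩, rfl⟩
  exact hint.const_smul ((ν 𝓕).toReal⁻¹ : ℝ)

omit [BorelSpace (quasiSplit F E c N).Adelic] in
/-- **(E2-bd)_B — THE JOINT LOCAL BOUND TRANSPORTS TO THE CONSTANT TERMS**: if `(p, g) ↦ Φ_p(g)` is locally bounded on `U × (compacts)` then so is `(p, g) ↦ (Φ_p)_B(g)`, for ANY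
measure `ν` and any `𝓕` of compact closure — for `p ∈ V`, `g ∈ K` the integrand `u ↦ Φ_p(u g)` is bounded on `𝓕` by the constant `M` of the compact `closure 𝓕 · K`, so
`‖(Φ_p)_B(g)‖ ≤ ν(𝓕)⁻¹ · M ν(𝓕) ≤ max M 0` (Mathlib `norm_setIntegral_le_of_norm_le_const`; `ν(𝓕) = ∞` gives the junk value `0`). [cite: MoeglinWaldspurger1995, II.1.7] [cite: Rogawski1990, §2.1] -/
theorem locally_bounded_borelConstantTerm_family {P : Type*} [TopologicalSpace P] (ν : Measure ↥(adelicUnipotent F E c N))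
    {𝓕 : Set ↥(adelicUnipotent F E c N)} (h𝓕c : IsCompact (closure 𝓕)) (Φ : P → (quasiSplit F E c N).Adelic → ℂ) {U : Set P}
    (hΦbd : ∀ p₀ ∈ U, ∀ K : Set (quasiSplit F E c N).Adelic, IsCompact K → ∃ V ∈ 𝓝 p₀, ∃ M : ℝ, ∀ p ∈ V, ∀ g ∈ K, ‖Φ p g‖ ≤ M) :
    ∀ p₀ ∈ U, ∀ K : Set (quasiSplit F E c N).Adelic, IsCompact K → ∃ V ∈ 𝓝 p₀, ∃ M : ℝ, ∀ p ∈ V, ∀ g ∈ K, ‖borelConstantTerm ν 𝓕 (Φ p) g‖ ≤ M := by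
  intro p₀ hp₀ K hK
  have hmul : Continuous fun q : ↥(adelicUnipotent F E c N) × (quasiSplit F E c N).Adelic => (q.1 : (quasiSplit F E c N).Adelic) * q.2 :=
    (continuous_subtype_val.comp continuous_fst).mul continuous_snd
  obtain ⟨V, hV, M, hM⟩ := hΦbd p₀ hp₀ _ ((h𝓕c.prod hK).image hmul)
  refine ⟨V, hV, max M 0, fun p hp g hg => ?_⟩
  have hM0 : 0 ≤ max M 0 := le_max_right _ _
  rw [borelConstantTerm_def, norm_smul, Real.norm_eq_abs, abs_inv, abs_of_nonneg ENNReal.toReal_nonneg]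
  rcases eq_or_ne (ν 𝓕) ∞ with htop | htop
  · rw [htop, ENNReal.toReal_top, inv_zero, zero_mul]
    exact hM0
  have hle : ‖∫ u in 𝓕, Φ p ((u : (quasiSplit F E c N).Adelic) * g) ∂ν‖ ≤ max M 0 * ν.real 𝓕 :=
    norm_setIntegral_le_of_norm_le_const htop.lt_top fun u hu => (hM p hp _ ⟨(u, g), ⟨subset_closure hu, hg⟩, rfl⟩).trans (le_max_left _ _)
  rw [measureReal_def] at hle
  calc (ν 𝓕).toReal⁻¹ * ‖∫ u in 𝓕, Φ p ((u : (quasiSplit F E c N).Adelic) * g) ∂ν‖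
      ≤ (ν 𝓕).toReal⁻¹ * (max M 0 * (ν 𝓕).toReal) := mul_le_mul_of_nonneg_left hle (inv_nonneg.2 ENNReal.toReal_nonneg)
    _ ≤ max M 0 := by
        rcases eq_or_ne (ν 𝓕).toReal 0 with h0 | h0
        · rw [h0, inv_zero, zero_mul]
          exact hM0
        · rw [mul_comm (max M 0), ← mul_assoc, inv_mul_cancel₀ h0, one_mul]

end General

/-! ## §4 Any `U(J_N)`: the middle coefficient of a section-shaped constant term inherits holomorphy (`hψa ⇐ hE3c`) -/

section MiddleCoefficient

variable {F E : Type} [Field F] [NumberField F] [Field E] [NumberField E] [Algebra F E] {c : E ≃ₐ[F] E} {N : ℕ} [NeZero N]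
variable [MeasurableSpace (quasiSplit F E c N).Adelic]

/-- **`hψa ⇐ hE3c` — THE MIDDLE COEFFICIENT `ψ_z(g) = ((Φ_z)_B(g) − φ(g)·H(g)^z) ∕ H(g)^{2−z}` IS HOLOMORPHIC ON `U` FOR EVERY `g`** as soon as `z ↦ (Φ_z)_B(g)` is (`hE3c`): `H(g) > 0`
(★ `borelHeight_pos`), so `z ↦ H(g)^z`, `z ↦ H(g)^{2−z}` are entire and the latter never vanishes, while `φ(g)` does not depend on `z`.  `ψ` is given DEF-FREE by the identity `hψdef`
on `U` (K2E1-p12's device: with it the section shape `(Φ_z)_B = φ·H^z + ψ_z·H^{2−z}` holds on all of `U` by `div_mul_cancel`), so this is the letter `hψa` of the (a-8) identity-theorem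
payer ★ `K2E1ChiConstantTermFactorisationContinuedU3.eventually_factorisation_of_unfolded`. [cite: MoeglinWaldspurger1995, II.1.7, IV.1.9] [cite: Rogawski1990, §2.1] -/
theorem differentiableOn_middleCoefficient_of_borelConstantTerm (ν : Measure ↥(adelicUnipotent F E c N)) (𝓕 : Set ↥(adelicUnipotent F E c N))
    (Φ : ℂ → (quasiSplit F E c N).Adelic → ℂ) {U : Set ℂ} (hE3c : ∀ g, DifferentiableOn ℂ (fun z => borelConstantTerm ν 𝓕 (Φ z) g) U)
    (φ : (quasiSplit F E c N).Adelic → ℂ) (ψ : ℂ → (quasiSplit F E c N).Adelic → ℂ)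
    (hψdef : ∀ z ∈ U, ∀ g : (quasiSplit F E c N).Adelic,
      ψ z g = (borelConstantTerm ν 𝓕 (Φ z) g - φ g * (((borelHeight g : ℝ≥0) : ℝ) : ℂ) ^ z) / (((borelHeight g : ℝ≥0) : ℝ) : ℂ) ^ (2 - z)) :
    ∀ g : (quasiSplit F E c N).Adelic, DifferentiableOn ℂ (fun z => ψ z g) U := fun g => by
  have hH : (((borelHeight g : ℝ≥0) : ℝ) : ℂ) ≠ 0 := Complex.ofReal_ne_zero.2 (NNReal.coe_pos.2 (borelHeight_pos g)).ne'
  have h1 : DifferentiableOn ℂ (fun z : ℂ => (((borelHeight g : ℝ≥0) : ℝ) : ℂ) ^ z) U := differentiableOn_id.const_cpow (Or.inl hH)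
  have h2 : DifferentiableOn ℂ (fun z : ℂ => (((borelHeight g : ℝ≥0) : ℝ) : ℂ) ^ (2 - z)) U :=
    ((differentiableOn_const (2 : ℂ)).sub differentiableOn_id).const_cpow (Or.inl hH)
  refine ((((hE3c g).sub ((differentiableOn_const (φ g)).mul h1)).div h2 fun z _ => ?_).congr fun z hz => hψdef z hz g)
  exact Complex.cpow_ne_zero_iff.2 (Or.inl hH)

end MiddleCoefficient

/-! ## §5 `U(2,1)_{L/L⁺}`: the heads on the slit plane `{1 < Re} ∖ Sp`, in the (V) assembly's binder bytes -/

section CM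

variable (L : Type) [Field L] [NumberField L] [IsCMField L]
variable [MeasurableSpace (quasiSplit (↥(maximalRealSubfield L)) L (IsCMField.complexConj L) 3).Adelic] [BorelSpace (quasiSplit (↥(maximalRealSubfield L)) L (IsCMField.complexConj L) 3).Adelic]

/-- **THE LETTER `hE3c` — `z ↦ (Ec z)_B(g)` IS HOLOMORPHIC ON THE SLIT PLANE `{1 < Re} ∖ Sp` FOR EVERY `g`**, for the continued pair-Eisenstein family `Ec` with the (V) assembly's
clauses `hEd` (pointwise holomorphy, ★ p863385 :285), `hE4` (continuity, :289), `hEbd` (joint local bound, :290), any Haar measure `ν` of the Heisenberg radical `N(𝔸_{L⁺})` and any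
fundamental domain `𝓕` of `N(L⁺)` of compact closure (:292–:294).  §1 on the open slit plane (`Sp` finite), with `ν(𝓕) ≤ ν(closure 𝓕) < ∞` (Haar, compact) and `𝓕` null-measurable
(fundamental domain).  This is the CT-holomorphy input of the identity-theorem continuation of the factorisation `(Ec z)_B = φ·H^z + ψ_z·H^{2−z}` from the tube `{2 < Re}` to the slit plane.
[cite: MoeglinWaldspurger1995, IV.1.9, II.1.7] [cite: Rogawski1990, §2.1] -/
theorem differentiableOn_borelConstantTerm_slitPlane_cm_three
    (Ec : ℂ → (quasiSplit (↥(maximalRealSubfield L)) L (IsCMField.complexConj L) 3).Adelic → ℂ) (Sp : Finset ℂ)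
    (hEd : ∀ g, DifferentiableOn ℂ (fun z => Ec z g) ({z : ℂ | 1 < z.re} \ (↑Sp : Set ℂ)))
    (hE4 : ∀ z ∈ ({z : ℂ | 1 < z.re} \ (↑Sp : Set ℂ)), Continuous (Ec z))
    (hEbd : ∀ z₁ ∈ ({z : ℂ | 1 < z.re} \ (↑Sp : Set ℂ)), ∀ K : Set (quasiSplit (↥(maximalRealSubfield L)) L (IsCMField.complexConj L) 3).Adelic, IsCompact K →
      ∃ V ∈ 𝓝 z₁, ∃ M : ℝ, ∀ z ∈ V, ∀ g ∈ K, ‖Ec z g‖ ≤ M)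
    (ν : Measure ↥(adelicUnipotent (↥(maximalRealSubfield L)) L (IsCMField.complexConj L) 3)) [ν.IsHaarMeasure]
    {𝓕 : Set ↥(adelicUnipotent (↥(maximalRealSubfield L)) L (IsCMField.complexConj L) 3)}
    (h𝓕N : IsFundamentalDomain ↥(rationalUnipotent (↥(maximalRealSubfield L)) L (IsCMField.complexConj L) 3) 𝓕 ν) (h𝓕c : IsCompact (closure 𝓕)) :
    ∀ g : (quasiSplit (↥(maximalRealSubfield L)) L (IsCMField.complexConj L) 3).Adelic,
      DifferentiableOn ℂ (fun z => borelConstantTerm ν 𝓕 (Ec z) g) ({z : ℂ | 1 < z.re} \ (↑Sp : Set ℂ)) := fun g =>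
  differentiableOn_borelConstantTerm_family ν h𝓕N.nullMeasurableSet ((measure_mono subset_closure).trans_lt h𝓕c.measure_lt_top).ne h𝓕c Ec
    ((isOpen_lt continuous_const Complex.continuous_re).sdiff Sp.finite_toSet.isClosed) hEd hE4 hEbd g

/-- **(E4)_B ON THE SLIT PLANE — `(Ec z)_B` IS CONTINUOUS FOR `z ∈ {1 < Re} ∖ Sp`** (continued pair-Eisenstein family with the (V) clause `hE4` :289; Haar `ν`, fundamental domain `𝓕`
of compact closure :292–:294): §2. [cite: MoeglinWaldspurger1995, II.1.7] [cite: Rogawski1990, §2.1] -/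
theorem continuous_borelConstantTerm_slitPlane_cm_three
    (Ec : ℂ → (quasiSplit (↥(maximalRealSubfield L)) L (IsCMField.complexConj L) 3).Adelic → ℂ) (Sp : Finset ℂ)
    (hE4 : ∀ z ∈ ({z : ℂ | 1 < z.re} \ (↑Sp : Set ℂ)), Continuous (Ec z))
    (ν : Measure ↥(adelicUnipotent (↥(maximalRealSubfield L)) L (IsCMField.complexConj L) 3)) [ν.IsHaarMeasure]
    {𝓕 : Set ↥(adelicUnipotent (↥(maximalRealSubfield L)) L (IsCMField.complexConj L) 3)}
    (h𝓕N : IsFundamentalDomain ↥(rationalUnipotent (↥(maximalRealSubfield L)) L (IsCMField.complexConj L) 3) 𝓕 ν) (h𝓕c : IsCompact (closure 𝓕)) :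
    ∀ z ∈ ({z : ℂ | 1 < z.re} \ (↑Sp : Set ℂ)), Continuous (borelConstantTerm ν 𝓕 (Ec z)) := fun z hz =>
  continuous_borelConstantTerm_of_continuous ν h𝓕N.nullMeasurableSet ((measure_mono subset_closure).trans_lt h𝓕c.measure_lt_top).ne h𝓕c (hE4 z hz)

omit [BorelSpace (quasiSplit (↥(maximalRealSubfield L)) L (IsCMField.complexConj L) 3).Adelic] in
/-- **(E2-bd)_B ON THE SLIT PLANE — THE JOINT LOCAL BOUND OF `(z, g) ↦ (Ec z)_B(g)`** (continued pair-Eisenstein family with the (V) clause `hEbd` :290; any `ν`, any `𝓕` of compact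
closure): §3.  With the two heads above, `z ↦ (Ec z)_B` carries the same three LAYER-2 letters as `Ec` on `{1 < Re} ∖ Sp`. [cite: MoeglinWaldspurger1995, II.1.7] [cite: Rogawski1990, §2.1] -/
theorem locally_bounded_borelConstantTerm_slitPlane_cm_three
    (Ec : ℂ → (quasiSplit (↥(maximalRealSubfield L)) L (IsCMField.complexConj L) 3).Adelic → ℂ) (Sp : Finset ℂ)
    (hEbd : ∀ z₁ ∈ ({z : ℂ | 1 < z.re} \ (↑Sp : Set ℂ)), ∀ K : Set (quasiSplit (↥(maximalRealSubfield L)) L (IsCMField.complexConj L) 3).Adelic, IsCompact K →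
      ∃ V ∈ 𝓝 z₁, ∃ M : ℝ, ∀ z ∈ V, ∀ g ∈ K, ‖Ec z g‖ ≤ M)
    (ν : Measure ↥(adelicUnipotent (↥(maximalRealSubfield L)) L (IsCMField.complexConj L) 3))
    {𝓕 : Set ↥(adelicUnipotent (↥(maximalRealSubfield L)) L (IsCMField.complexConj L) 3)} (h𝓕c : IsCompact (closure 𝓕)) :
    ∀ z₁ ∈ ({z : ℂ | 1 < z.re} \ (↑Sp : Set ℂ)), ∀ K : Set (quasiSplit (↥(maximalRealSubfield L)) L (IsCMField.complexConj L) 3).Adelic, IsCompact K →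
      ∃ V ∈ 𝓝 z₁, ∃ M : ℝ, ∀ z ∈ V, ∀ g ∈ K, ‖borelConstantTerm ν 𝓕 (Ec z) g‖ ≤ M :=
  locally_bounded_borelConstantTerm_family ν h𝓕c Ec hEbd

/-- **`hψa` ON THE SLIT PLANE FROM `hE3c`'s INPUTS** — for the continued pair-Eisenstein family with the (V) clauses `hEd hE4 hEbd` (:285, :289, :290), Haar `ν` and a fundamental domain
`𝓕` of compact closure (:292–:294), the def-free middle coefficient `ψ_z(g) = ((Ec z)_B(g) − φ(g)·H(g)^z) ∕ H(g)^{2−z}` (identity `hψdef` on the slit plane) is holomorphic on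
`{1 < Re} ∖ Sp` for every `g`: the (a-8) payer's letter `hψa` BY NAME (§4 ∘ `hE3c`). [cite: MoeglinWaldspurger1995, IV.1.9, II.1.7] [cite: Rogawski1990, §2.1] -/
theorem differentiableOn_middleCoefficient_slitPlane_cm_three
    (Ec : ℂ → (quasiSplit (↥(maximalRealSubfield L)) L (IsCMField.complexConj L) 3).Adelic → ℂ) (Sp : Finset ℂ)
    (hEd : ∀ g, DifferentiableOn ℂ (fun z => Ec z g) ({z : ℂ | 1 < z.re} \ (↑Sp : Set ℂ)))
    (hE4 : ∀ z ∈ ({z : ℂ | 1 < z.re} \ (↑Sp : Set ℂ)), Continuous (Ec z))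
    (hEbd : ∀ z₁ ∈ ({z : ℂ | 1 < z.re} \ (↑Sp : Set ℂ)), ∀ K : Set (quasiSplit (↥(maximalRealSubfield L)) L (IsCMField.complexConj L) 3).Adelic, IsCompact K →
      ∃ V ∈ 𝓝 z₁, ∃ M : ℝ, ∀ z ∈ V, ∀ g ∈ K, ‖Ec z g‖ ≤ M)
    (ν : Measure ↥(adelicUnipotent (↥(maximalRealSubfield L)) L (IsCMField.complexConj L) 3)) [ν.IsHaarMeasure]
    {𝓕 : Set ↥(adelicUnipotent (↥(maximalRealSubfield L)) L (IsCMField.complexConj L) 3)}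
    (h𝓕N : IsFundamentalDomain ↥(rationalUnipotent (↥(maximalRealSubfield L)) L (IsCMField.complexConj L) 3) 𝓕 ν) (h𝓕c : IsCompact (closure 𝓕))
    (φ : (quasiSplit (↥(maximalRealSubfield L)) L (IsCMField.complexConj L) 3).Adelic → ℂ) (ψ : ℂ → (quasiSplit (↥(maximalRealSubfield L)) L (IsCMField.complexConj L) 3).Adelic → ℂ)
    (hψdef : ∀ z ∈ ({z : ℂ | 1 < z.re} \ (↑Sp : Set ℂ)), ∀ g : (quasiSplit (↥(maximalRealSubfield L)) L (IsCMField.complexConj L) 3).Adelic,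
      ψ z g = (borelConstantTerm ν 𝓕 (Ec z) g - φ g * (((borelHeight g : ℝ≥0) : ℝ) : ℂ) ^ z) / (((borelHeight g : ℝ≥0) : ℝ) : ℂ) ^ (2 - z)) :
    ∀ g : (quasiSplit (↥(maximalRealSubfield L)) L (IsCMField.complexConj L) 3).Adelic, DifferentiableOn ℂ (fun z => ψ z g) ({z : ℂ | 1 < z.re} \ (↑Sp : Set ℂ)) :=
  differentiableOn_middleCoefficient_of_borelConstantTerm ν 𝓕 Ec (differentiableOn_borelConstantTerm_slitPlane_cm_three L Ec Sp hEd hE4 hEbd ν h𝓕N h𝓕c) φ ψ hψdef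

end CM

end Summit.HodgeConjecture.HodgeConjecture.Cruxes.H413.K2E1ChiConstantTermHolomorphicCMThree

end
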